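import Summits.CriticalPhenomena.PercolationContinuityZ3.Theorems.PercNearOneGluingNoHeavyQuantCatHullLeafKinds
import Summits.CriticalPhenomena.PercolationContinuityZ3.Theorems.PercNearOneGluingNoHeavyQuantLightPairTreeBuilt
import HarnessLib

/-!
# QUANT lane R8, T-DEC: THE CERTIFICATE CHECKER FOR THE LIGHT CORNER — data format `CertData` (ψ, eleven tables, fuel), the Boolean `CertData.check`,
# and its soundness: a passing certificate EXCLUDES `lpT 4 (17/25) (499/680)` from `InGatedCatHull (997/2000) (669/125) 10`, hence refutes
# `TreeBuiltCatHullLight` and `CatPairLight`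

builds on p205010 (kernel theorem, internal audit signed; external expert review pending)

Support file (`--supports stmt-CriticalPhenomena-4575`), QUANT lane census seat prim-quant-census-2 (gen 78).  Definitions + theorems; standard axioms,
no sorries; NO data here (the table and `native_decide` live in the sequel).  `CertData.check D` runs: well-formedness of the eleven offset tables
(shared `G`-grid from `y = 997/2000` to `1`, `A`-range `[0, 10−u]`), nonnegative slopes and the tip check at offsets in `S = {0,1,2,5,6,10}`, the exact
shift check between consecutive offsets, the exact leaf checks for the 30 admissible `(u, a)` pairs (kinds read off `CertData.leafList`, whose
correctness `CertData.kind_spec` is decided in the kernel), and the final strict inequality `ψ 0 + Z₀(1, T) < Σ ψ(h)·lpT(h)`.  `CertData.valueBound`: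
`check = true ⟹ CatValueBoundS S ψ y 10 Z`; `CertData.not_mem`: `⟹ lpT 4 (17/25) (499/680) ∉ InGatedCatHull (997/2000) (669/125) 10`;
`CertData.not_treeBuiltCatHullLight` / `CertData.not_catPairLight` via `lpT_inGatedCatHull_of_treeBuiltCatHullLight` / `…_of_catPairLight`
(floor `997/2000 < qs = 499/1000 < 1/2`).  Instance: census-2 g78 (kit margin scan j274656: the B&B margin at this corner is 9.0e-3, 3.3× the g77 corner's).
[this work].  Nothing here is cited as a published result.  The gluing rows served [cite: KozmaNitzan2024, Conjecture 3 (p. 15)]; product measure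
[cite: Grimmett1999, §1.3 p. 10].
-/

noncomputable section

open scoped BigOperators

namespace Summit.CriticalPhenomena.PercolationContinuityZ3.Theorems
namespace Quant
namespace LawDec

open Finset Tab

/-- **certificate data**: floor `y`, the functional `ψ` at offsets `0..10`, one table per offset `0..10`, bisection fuel. [this work] -/
structure CertData where
  y : ℚ
  psi : List ℚ
  tab : List Tab
  fuel : ℕ

namespace CertData

/-- the support of the target law. [this work] -/
def S : Finset ℕ := {0, 1, 2, 5, 6, 10}

/-- `ψ` (rational). [this work] -/
def ψq (D : CertData) (u : ℕ) : ℚ := D.psi.getD u 0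
/-- `ψ` (real). [this work] -/
def ψ (D : CertData) (u : ℕ) : ℝ := (D.ψq u : ℝ)
/-- the table of offset `u`. [this work] -/
def Tu (D : CertData) (u : ℕ) : Tab := D.tab.getD u ⟨[], [], []⟩
/-- the value bound (real semantics). [this work] -/
def Z (D : CertData) (u : ℕ) (G A : ℝ) : ℝ := (D.Tu u).Z G A

/-- **the admissible leaves**: `(u, a, kind, d)` — kind `1` = one atom `d`, `2` = atoms `{0,4}`, `3` = `{0,1,5}`, `4` = `{1,2,6}` (census-2 g78's enumeration
of the pairs `(u,a)` with `{h : u+h ∈ S, u+a+h ∈ S} ≠ ∅`). [this work] -/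
def leafList : List (ℕ × ℕ × ℕ × ℕ) :=
  [(0,1,3,0), (0,2,1,0), (0,3,1,2), (0,4,4,0), (0,5,3,0), (0,6,1,0), (0,8,1,2), (0,9,1,1), (0,10,1,0), (1,1,2,0), (1,3,1,1), (1,4,3,0), (1,5,2,0),
   (1,8,1,1), (1,9,1,0), (2,1,1,3), (2,3,1,0), (2,4,2,0), (2,5,1,3), (2,8,1,0), (3,1,1,2), (3,4,1,3), (3,5,1,2), (4,1,1,1), (4,4,1,2), (4,5,1,1),
   (5,1,1,0), (5,4,1,1), (5,5,1,0), (6,4,1,0)]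

/-- the kind of `(u, a)` (`(0, 0)` when the pair is not admissible). [this work] -/
def kindOf (u a : ℕ) : ℕ × ℕ := ((leafList.find? fun e => e.1 = u ∧ e.2.1 = a).map fun e => e.2.2).getD (0, 0)

/-- the clause a support atom `k` of the sub-law must satisfy, by kind. [this work] -/
def kindClause (u a k : ℕ) : Prop :=
  let c := (kindOf u a).1
  let d := (kindOf u a).2
  (c = 1 ∧ k = d ∧ u + a + d ≤ 10) ∨ (c = 2 ∧ (k = 0 ∨ k = 4) ∧ u + a + 4 ≤ 10) ∨ (c = 3 ∧ (k = 0 ∨ k = 1 ∨ k = 5) ∧ u + a + 5 ≤ 10) ∨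
    (c = 4 ∧ (k = 1 ∨ k = 2 ∨ k = 6) ∧ u + a + 6 ≤ 10)

/-- the clause is decidable. [this work] -/
instance (u a k : ℕ) : Decidable (kindClause u a k) := by unfold kindClause; infer_instance

/-- the enumeration check as a closed Boolean. [this work] -/
def kindSpecB : Bool :=
  (List.range 11).all fun u => (List.range 11).all fun a => (List.range 11).all fun k =>
    !(decide (1 ≤ a) && decide (u + k ∈ S) && decide (u + a + k ∈ S)) || decide (kindClause u a k)

/-- the enumeration check passes (kernel evaluation). [this work] -/
theorem kindSpecB_true : kindSpecB = true := by decide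

/-- **the enumeration is correct**: an atom `k` with `u + k ∈ S` and `u + a + k ∈ S` (`a ≥ 1`) satisfies the clause of `kindOf u a`. [this work] -/
theorem kind_spec {u a k : ℕ} (hu : u < 11) (ha11 : a < 11) (ha : 1 ≤ a) (hk : k < 11) (h1 : u + k ∈ S) (h2 : u + a + k ∈ S) :
    kindClause u a k := by
  have h := kindSpecB_true
  unfold kindSpecB at h
  rw [List.all_eq_true] at h
  have h := h u (List.mem_range.2 hu); rw [List.all_eq_true] at h
  have h := h a (List.mem_range.2 ha11); rw [List.all_eq_true] at h
  have h := h k (List.mem_range.2 hk)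
  simp only [Bool.or_eq_true, Bool.not_eq_true', Bool.and_eq_false_iff, decide_eq_false_iff_not, decide_eq_true_eq] at h
  rcases h with ((h | h) | h) | h
  · exact absurd ha h
  · exact absurd h1 h
  · exact absurd h2 h
  · exact h

/-- the leaf checks of all admissible pairs. [this work] -/
def leafChecks (D : CertData) : Bool :=
  leafList.all fun e =>
    let u := e.1; let a := e.2.1; let c := e.2.2.1; let d := e.2.2.2
    if c = 1 then leafChk D.ψq D.y (D.Tu u) D.fuel u a d (d + 11) (d + 12) Mode.zero
    else if c = 2 then leafChk D.ψq D.y (D.Tu u) D.fuel u a 0 4 11 Mode.zero && leafChk D.ψq D.y (D.Tu u) D.fuel u a 0 4 11 Mode.seg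
    else if c = 3 then leafChk D.ψq D.y (D.Tu u) D.fuel u a 0 1 5 Mode.zero && leafChk D.ψq D.y (D.Tu u) D.fuel u a 0 1 5 Mode.seg &&
        leafChk D.ψq D.y (D.Tu u) D.fuel u a 0 1 5 Mode.tri
    else leafChk D.ψq D.y (D.Tu u) D.fuel u a 1 2 6 Mode.zero && leafChk D.ψq D.y (D.Tu u) D.fuel u a 1 2 6 Mode.seg &&
        leafChk D.ψq D.y (D.Tu u) D.fuel u a 1 2 6 Mode.tri

/-- structural checks of the eleven tables + monotonicity/tip on `S` + the exact shift check between consecutive offsets. [this work] -/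
def structChecks (D : CertData) : Bool :=
  decide (0 < D.y) && decide (D.y < 1) &&
  ((List.range 11).all fun u => (D.Tu u).wf && decide ((D.Tu u).gb.getD 0 0 = D.y) && decide ((D.Tu u).gb.getLast?.getD 0 = 1) &&
      decide ((D.Tu u).ab.getLast?.getD 0 = 10 - (u : ℚ))) &&
  ([0, 1, 2, 5, 6, 10].all fun u => (D.Tu u).slopesOK && (D.Tu u).tipOK) &&
  ((List.range 10).all fun u => shiftOK (D.Tu u) (D.Tu (u + 1)) 1 (D.ψq (u + 1) - D.ψq u))

/-! ### Soundness: the value bound -/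

/-- table facts from the structural checks. [this work] -/
theorem struct_wf {D : CertData} (h : D.structChecks = true) {u : ℕ} (hu : u < 11) :
    (D.Tu u).wf = true ∧ (D.Tu u).gb.getD 0 0 = D.y ∧ (D.Tu u).gb.getLast?.getD 0 = 1 ∧ (D.Tu u).ab.getLast?.getD 0 = 10 - (u : ℚ) := by
  unfold structChecks at h
  simp only [Bool.and_eq_true, decide_eq_true_eq, List.all_eq_true] at h
  obtain ⟨⟨⟨_, hall⟩, _⟩, _⟩ := h
  have := hall u (List.mem_range.2 hu)
  exact ⟨this.1.1.1, this.1.1.2, this.1.2, this.2⟩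

/-- a well-formed table starts its `A`-grid at `0`. [this work] -/
theorem ab0_of_wf {T : Tab} (hw : T.wf = true) : T.ab.getD 0 0 = 0 := by
  unfold Tab.wf at hw; simp only [Bool.and_eq_true, decide_eq_true_eq] at hw
  obtain ⟨⟨⟨⟨⟨_, _⟩, hl⟩, hab0⟩, _⟩, _⟩ := hw
  rw [List.getD_eq_getElem _ _ (by omega)]; rw [List.getD_eq_getElem _ _ (by omega)] at hab0; exact hab0

/-- one consecutive shift step. [this work] -/
theorem shift_step {D : CertData} (hs : D.structChecks = true) {v : ℕ} (hv : v + 1 ≤ 10) {G A : ℝ} (hyG : (D.y : ℝ) < G) (hG1 : G ≤ 1)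
    (hA0 : 0 ≤ A) (hA1 : A ≤ G * (10 - ((v + 1 : ℕ) : ℝ))) :
    D.Z (v + 1) G A + G * (D.ψ (v + 1) - D.ψ v) ≤ D.Z v G (A + G) := by
  have hs' := hs
  unfold structChecks at hs'
  simp only [Bool.and_eq_true, decide_eq_true_eq, List.all_eq_true] at hs'
  obtain ⟨⟨⟨⟨hy0, _⟩, _⟩, _⟩, hsh⟩ := hs'
  obtain ⟨hw, hg0, hg1, hab⟩ := struct_wf hs (by omega : v < 11)
  obtain ⟨hw', hg0', hg1', hab'⟩ := struct_wf hs (by omega : v + 1 < 11)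
  have hchk := hsh v (List.mem_range.2 (by omega))
  have hyp : (0:ℝ) < D.y := by exact_mod_cast hy0
  have hG0 : 0 ≤ G := by linarith
  have hv' : (v : ℝ) + 1 ≤ 10 := by exact_mod_cast hv
  have hA1' : A ≤ G * (10 - ((v : ℝ) + 1)) := by push_cast at hA1; exact hA1
  have hGle : G * (10 - ((v : ℝ) + 1)) ≤ 10 - ((v : ℝ) + 1) := by nlinarith
  have ha0 : (((D.Tu (v + 1)).ab.getD 0 0 : ℚ) : ℝ) ≤ A := by rw [ab0_of_wf hw']; simpa using hA0
  have ha1 : A ≤ (((D.Tu (v + 1)).ab.getLast?.getD 0 : ℚ) : ℝ) := by rw [hab']; push_cast; linarith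
  have hb0 : (((D.Tu v).ab.getD 0 0 : ℚ) : ℝ) ≤ A + G * ((1 : ℕ) : ℝ) := by rw [ab0_of_wf hw]; push_cast; nlinarith
  have hb1 : A + G * ((1 : ℕ) : ℝ) ≤ (((D.Tu v).ab.getLast?.getD 0 : ℚ) : ℝ) := by rw [hab]; push_cast; nlinarith
  have key := shift_sound (Ts := D.Tu v) (Ts' := D.Tu (v + 1)) (δ := 1) (dψ := D.ψq (v + 1) - D.ψq v) hchk hw hw' (G := G) (A := A)
    (by rw [hg0']; exact hyG.le) (by rw [hg1']; exact_mod_cast hG1) ha0 ha1 hb0 hb1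
  unfold Z ψ
  push_cast at key ⊢
  simpa using key

/-- all shifts, by chaining consecutive steps. [this work] -/
theorem shift_all {D : CertData} (hs : D.structChecks = true) :
    ∀ (b u : ℕ) (G A : ℝ), (D.y : ℝ) < G → G ≤ 1 → 0 ≤ A → A ≤ G * (10 - ((u + (b + 1) : ℕ) : ℝ)) →
      D.Z (u + (b + 1)) G A + G * (D.ψ (u + (b + 1)) - D.ψ u) ≤ D.Z u G (A + G * ((b + 1 : ℕ) : ℝ))
  | 0, u, G, A, hyG, hG1, hA0, hAB => by
    have hu : u + 1 ≤ 10 := by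
      by_contra hc; push Not at hc
      have : (10 : ℝ) - ((u + (0 + 1) : ℕ) : ℝ) < 0 := by
        have : (10 : ℝ) < ((u + (0 + 1) : ℕ) : ℝ) := by exact_mod_cast (by omega : 10 < u + (0 + 1))
        linarith
      have hG : 0 < G := by
        have hs' := hs; unfold structChecks at hs'; simp only [Bool.and_eq_true, decide_eq_true_eq] at hs'
        have : (0:ℝ) < D.y := by exact_mod_cast hs'.1.1.1.1
        linarith
      nlinarith
    have := shift_step hs hu hyG hG1 hA0 (by simpa using hAB)
    simpa using this
  | b + 1, u, G, A, hyG, hG1, hA0, hAB => by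
    have hs' := hs; unfold structChecks at hs'; simp only [Bool.and_eq_true, decide_eq_true_eq] at hs'
    have hyp : (0:ℝ) < D.y := by exact_mod_cast hs'.1.1.1.1
    have hG : 0 < G := by linarith
    have hub : u + (b + 2) ≤ 10 := by
      by_contra hc; push Not at hc
      have : (10 : ℝ) - ((u + (b + 1 + 1) : ℕ) : ℝ) < 0 := by
        have : (10 : ℝ) < ((u + (b + 1 + 1) : ℕ) : ℝ) := by exact_mod_cast (by omega : 10 < u + (b + 1 + 1))
        linarith
      nlinarith
    -- inner step at offset u + (b+1)
    have e1 : u + (b + 1 + 1) = (u + (b + 1)) + 1 := by ring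
    have s1 := shift_step hs (v := u + (b + 1)) (by omega) hyG hG1 hA0 (by rw [← e1]; exact hAB)
    -- IH from offset u + (b+1) down to u, at A + G
    have hAB' : A + G ≤ G * (10 - ((u + (b + 1) : ℕ) : ℝ)) := by push_cast at hAB ⊢; nlinarith
    have s2 := shift_all hs b u G (A + G) hyG hG1 (by nlinarith) hAB'
    rw [e1]
    have e3 : A + G * ((b + 1 + 1 : ℕ) : ℝ) = A + G + G * ((b + 1 : ℕ) : ℝ) := by push_cast; ring
    rw [e3]
    have e4 : D.ψ (u + (b + 1) + 1) - D.ψ u = (D.ψ (u + (b + 1) + 1) - D.ψ (u + (b + 1))) + (D.ψ (u + (b + 1)) - D.ψ u) := by ring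
    rw [e4, mul_add]
    linarith

/-- **SOUNDNESS: a passing certificate is an offset value bound.** [this work] -/
theorem valueBound (D : CertData) (hs : D.structChecks = true) (hl : D.leafChecks = true) : CatValueBoundS S D.ψ (D.y : ℝ) 10 D.Z := by
  have hs' := hs
  unfold structChecks at hs'
  simp only [Bool.and_eq_true, decide_eq_true_eq, List.all_eq_true] at hs'
  obtain ⟨⟨⟨⟨hy0, hy1⟩, hall⟩, hS⟩, hsh⟩ := hs'
  have hyR : (0 : ℝ) < D.y := by exact_mod_cast hy0
  refine ⟨?_, ?_, ?_, ?_⟩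
  · -- tip
    intro u hu G hyG hG1
    have hu11 : u < 11 := by unfold S at hu; simp at hu; omega
    obtain ⟨hw, hg0, _, _⟩ := struct_wf hs hu11
    have hmem : u ∈ [0, 1, 2, 5, 6, 10] := by unfold S at hu; simpa using hu
    obtain ⟨_, htip⟩ := hS u hmem
    have hle : (((D.Tu u).gb.getD 0 0 : ℚ) : ℝ) ≤ G := by rw [hg0]; exact hyG.le
    exact Z_tip hw htip hle
  · -- mono (u ∈ S)
    intro u hu G G' A _ hGG' _ _ _
    have hmem : u ∈ [0, 1, 2, 5, 6, 10] := by unfold S at hu; simpa using hu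
    obtain ⟨hsl, _⟩ := hS u hmem
    exact Z_mono hsl hGG' A
  · -- shift
    intro u a G A ha hyG hG1 hA0 hAB
    obtain ⟨b, rfl⟩ : ∃ b, a = b + 1 := ⟨a - 1, by omega⟩
    exact shift_all hs b u G A hyG hG1 hA0 hAB
  · -- leaf
    intro u a G g x N ν ha hyG hG1 hGx hxg hgl hcat hsupp
    obtain ⟨f0, fN, f1, _⟩ := hcat.lawFacts
    have hx1 : x < 1 := hcat.floor.2
    have hG : 0 < G := hyR.trans hyG
    have hne : ∃ k, ν k ≠ 0 := by
      by_contra hc; push Not at hc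
      exact law_supp_nonempty fN f1 fun k hk => hk (hc k)
    obtain ⟨k₀, hk₀⟩ := hne
    have memS : ∀ {n : ℕ}, n ∈ S → n ≤ 10 := by intro n hn; unfold S at hn; simp at hn; omega
    have hu : u < 11 := by have := memS (hsupp k₀ hk₀).1; omega
    have ha11 : a < 11 := by have := memS (hsupp k₀ hk₀).2; omega
    have clause : ∀ k, ν k ≠ 0 → kindClause u a k := fun k hk =>
      kind_spec hu ha11 ha (by have := memS (hsupp k hk).1; omega) (hsupp k hk).1 (hsupp k hk).2
    obtain ⟨tw, tg0, tg1, tab⟩ := struct_wf hs hu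
    unfold leafChecks at hl; rw [List.all_eq_true] at hl
    -- membership of the entry (u, a, kindOf u a)
    have hfind : (kindOf u a).1 ≠ 0 → (u, a, (kindOf u a).1, (kindOf u a).2) ∈ leafList := by
      intro hc0
      unfold kindOf at hc0 ⊢
      cases hf : (leafList.find? fun e => e.1 = u ∧ e.2.1 = a) with
      | none => exfalso; apply hc0; rw [hf]; rfl
      | some e =>
        have hm := List.mem_of_find?_eq_some hf
        have hp := List.find?_some hf
        simp only [decide_eq_true_eq] at hp
        rcases e with ⟨e1, e2, e3, e4⟩
        simp only at hp
        obtain ⟨rfl, rfl⟩ := hp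
        simpa using hm
    -- bound on the absolute mean from a bound on the atoms
    have hAof : ∀ (m : ℕ), (∀ k, ν k ≠ 0 → k ≤ m) → u + a + m ≤ 10 → G * (lmean N ν + a * g) ≤ (((D.Tu u).ab.getLast?.getD 0 : ℚ) : ℝ) := by
      intro m hm hum
      rw [tab]; push_cast
      have hlm : lmean N ν ≤ m := by
        unfold lmean
        calc ∑ h ∈ Finset.range (N + 1), (h : ℝ) * ν h ≤ ∑ h ∈ Finset.range (N + 1), (m : ℝ) * ν h := by
              refine Finset.sum_le_sum fun h _ => ?_
              by_cases hz : ν h = 0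
              · rw [hz, mul_zero, mul_zero]
              · exact mul_le_mul_of_nonneg_right (by exact_mod_cast hm h hz) (f0 h)
          _ = m := by rw [← Finset.mul_sum, f1, mul_one]
      have hg0' : 0 ≤ g := le_trans hcat.floor.1.le hxg
      have h1 : lmean N ν + a * g ≤ (m : ℝ) + a := by nlinarith [(Nat.cast_nonneg a : (0:ℝ) ≤ a), hgl.le]
      have h2 : ((m : ℝ) + a) ≤ 10 - u := by
        have : ((u + a + m : ℕ) : ℝ) ≤ 10 := by exact_mod_cast hum
        push_cast at this; linarith
      have h3 : 0 ≤ lmean N ν + a * g := add_nonneg (lmean_nonneg f0) (mul_nonneg (Nat.cast_nonneg a) hg0')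
      nlinarith
    rcases clause k₀ hk₀ with ⟨hc1, _, hsum⟩ | ⟨hc2, _, hsum⟩ | ⟨hc3, _, hsum⟩ | ⟨hc4, _, hsum⟩
    · -- one atom d
      have hsf : ∀ k, ν k ≠ 0 → k = (kindOf u a).2 := fun k hk => by
        rcases clause k hk with ⟨_, h, _⟩ | ⟨h, _⟩ | ⟨h, _⟩ | ⟨h, _⟩ <;> first | exact h | (exfalso; omega)
      have hchk := hl _ (hfind (by omega))
      simp only [hc1] at hchk; norm_num at hchk
      exact leaf_one D.ψq D.y (D.Tu u) D.fuel u a (kindOf u a).2 hchk tw tg0 tg1 f0 fN f1 hsf (x := x) hy0 hyG hG1 hGx hx1 hxg hgl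
        (hAof _ (fun k hk => (hsf k hk).le) hsum)
    · -- atoms {0,4}
      have hsf : ∀ k, ν k ≠ 0 → k = 0 ∨ k = 4 := fun k hk => by
        rcases clause k hk with ⟨h, _⟩ | ⟨_, h, _⟩ | ⟨h, _⟩ | ⟨h, _⟩ <;> first | exact h | (exfalso; omega)
      have hchk := hl _ (hfind (by omega))
      simp only [hc2] at hchk; norm_num at hchk
      have hreg := catBuilt_supp04 hcat hsf
      exact leaf_two D.ψq D.y (D.Tu u) D.fuel u a hchk.1 hchk.2 tw tg0 tg1 f0 fN f1 hsf hreg hy0 hyG hG1 hGx hx1 hxg hgl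
        (hAof 4 (fun k hk => by rcases hsf k hk with h | h <;> omega) hsum)
    · -- atoms {0,1,5}
      have hsf : ∀ k, ν k ≠ 0 → k = 0 ∨ k = 1 ∨ k = 5 := fun k hk => by
        rcases clause k hk with ⟨h, _⟩ | ⟨h, _⟩ | ⟨_, h, _⟩ | ⟨h, _⟩ <;> first | exact h | (exfalso; omega)
      have hchk := hl _ (hfind (by omega))
      simp only [hc3] at hchk; norm_num at hchk
      have hreg := catBuilt_supp015 hcat hsf
      exact leaf_three D.ψq D.y (D.Tu u) D.fuel u a 0 1 5 hchk.1.1 (fun _ => hchk.1.2) (fun _ => hchk.2) tw tg0 tg1 (by norm_num)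
        (by norm_num) (by norm_num) f0 fN f1 hsf hreg hy0 hyG hG1 hGx hx1 hxg hgl
        (hAof 5 (fun k hk => by rcases hsf k hk with h | h | h <;> omega) hsum)
    · -- atoms {1,2,6}
      have hsf : ∀ k, ν k ≠ 0 → k = 1 ∨ k = 2 ∨ k = 6 := fun k hk => by
        rcases clause k hk with ⟨h, _⟩ | ⟨h, _⟩ | ⟨h, _⟩ | ⟨_, h, _⟩ <;> first | exact h | (exfalso; omega)
      have hchk := hl _ (hfind (by omega))
      simp only [hc4] at hchk; norm_num at hchk
      have hreg := catBuilt_supp126 hcat hsf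
      exact leaf_three D.ψq D.y (D.Tu u) D.fuel u a 1 2 6 hchk.1.1 (fun _ => hchk.1.2) (fun _ => hchk.2) tw tg0 tg1 (by norm_num)
        (by norm_num) (by norm_num) f0 fN f1 hsf hreg hy0 hyG hG1 hGx hx1 hxg hgl
        (hAof 6 (fun k hk => by rcases hsf k hk with h | h | h <;> omega) hsum)

/-! ### The instance: final check and the refutations -/

/-- the target law `lpT 4 (17/25) (499/680) = (.32δ₀ + .181δ₁ + .499δ₅)^{∗2}` as exact rationals. [this work] -/
def lpTq (h : ℕ) : ℚ :=
  if h = 0 then 64 / 625 else if h = 1 then 11584 / 100000 else if h = 2 then 32761 / 1000000 else if h = 5 then 31936 / 100000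
  else if h = 6 then 180638 / 1000000 else if h = 10 then 249001 / 1000000 else 0

/-- the value form of the target law. [this work] -/
theorem lpT_val (h : ℕ) : lpT 4 (17 / 25) (499 / 680) h = (lpTq h : ℝ) := by
  rw [lpT_apply]; simp only [pointLaw_apply]
  rcases Nat.lt_or_ge h 11 with hlt | hge
  · interval_cases h <;> norm_num [lpTq]
  · simp [lpTq, show h ≠ 0 by omega, show h ≠ 1 by omega, show h ≠ 2 by omega, show h ≠ 4 + 1 by omega, show h ≠ 4 + 2 by omega,
      show h ≠ 2 * 4 + 2 by omega]

/-- the support of the target law lies in `S`. [this work] -/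
theorem lpT_supp (h : ℕ) (hh : lpT 4 (17 / 25) (499 / 680) h ≠ 0) : h ∈ S := by
  rw [lpT_val] at hh
  unfold lpTq at hh; unfold S
  by_contra hc
  simp only [Finset.mem_insert, Finset.mem_singleton, not_or] at hc
  obtain ⟨h0, h1, h2, h5, h6, h10⟩ := hc
  simp [h0, h1, h2, h5, h6, h10] at hh

/-- **the final strict inequality** `ψ 0 + Z₀(1, T) < Σ ψ(h)·lpT(h)` (exact rational check) and the instance constants. [this work] -/
def finalOK (D : CertData) : Bool :=
  decide (D.y = 997 / 2000) && decide (D.ψq 0 + (D.Tu 0).ZQ 1 (669 / 125) < ∑ h ∈ Finset.range 11, D.ψq h * lpTq h)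

/-- **the complete check.** [this work] -/
def check (D : CertData) : Bool := D.structChecks && D.leafChecks && D.finalOK

/-- **SOUNDNESS OF THE CERTIFICATE: the light glued pair at the new corner is OUTSIDE the gated caterpillar hull at floor `997/2000`.** [this work] -/
theorem not_mem (D : CertData) (h : D.check = true) : ¬ InGatedCatHull (997 / 2000 : ℝ) (669 / 125) 10 (lpT 4 (17 / 25) (499 / 680)) := by
  unfold check at h; simp only [Bool.and_eq_true] at h
  obtain ⟨⟨hs, hl⟩, hf⟩ := h
  unfold finalOK at hf; simp only [Bool.and_eq_true, decide_eq_true_eq] at hf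
  obtain ⟨hy, hsep⟩ := hf
  have hyR : (0 : ℝ) < D.y := by rw [hy]; norm_num
  have hV := valueBound D hs hl
  have hB : ∀ s ∈ S, (s : ℝ) ≤ 10 := by intro s hs'; unfold S at hs'; simp at hs'; rcases hs' with rfl | rfl | rfl | rfl | rfl | rfl <;> norm_num
  have key := not_inGatedCatHull_of_valueBoundS hV hyR hB (T := 669 / 125) (M := 10) (μ₀ := lpT 4 (17 / 25) (499 / 680)) lpT_supp ?_
  · have e : ((D.y : ℚ) : ℝ) = 997 / 2000 := by rw [hy]; norm_num
    rwa [e] at key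
  · -- the separation, transported from ℚ
    have hZ : D.Z 0 1 (669 / 125) = (((D.Tu 0).ZQ 1 (669 / 125) : ℚ) : ℝ) := by
      have := Z_cast (D.Tu 0) 1 (669 / 125); push_cast at this; exact this
    have hsum : ∑ h ∈ Finset.range (10 + 1), D.ψ h * lpT 4 (17 / 25) (499 / 680) h = ((∑ h ∈ Finset.range 11, D.ψq h * lpTq h : ℚ) : ℝ) := by
      push_cast; refine Finset.sum_congr rfl fun h _ => ?_; rw [lpT_val]; rfl
    rw [hsum, hZ]; unfold ψ; exact_mod_cast hsep

/-- **¬ `TreeBuiltCatHullLight`** from a passing certificate: the node predicts membership of `lpT 4 (17/25) (499/680)` (tree-built at every floor below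
`qs = 499/1000`) at the light floor `997/2000`. [this work] -/
theorem not_treeBuiltCatHullLight (D : CertData) (h : D.check = true) : ¬ TreeBuiltCatHullLight := by
  intro hL
  have key := lpT_inGatedCatHull_of_treeBuiltCatHullLight hL 4 (17 / 25) (499 / 680) (997 / 2000) (by norm_num) (by norm_num) (by norm_num)
    (by norm_num) (by norm_num) (by norm_num)
  have e : 2 * (17 / 25 : ℝ) * (1 + (4 : ℕ) * (499 / 680 : ℝ)) = 669 / 125 := by norm_num
  rw [e] at key
  exact not_mem D h key

/-- **¬ `CatPairLight`** from a passing certificate: (P) predicts membership at every light floor `≤ qs`, in particular at `997/2000`. [this work] -/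
theorem not_catPairLight (D : CertData) (h : D.check = true) : ¬ CatPairLight := by
  intro hP
  have key := lpT_inGatedCatHull_of_catPairLight hP 4 (17 / 25) (499 / 680) (997 / 2000) (by norm_num) (by norm_num) (by norm_num) (by norm_num)
    (by norm_num) (by norm_num)
  have e : 2 * (17 / 25 : ℝ) * (1 + (4 : ℕ) * (499 / 680 : ℝ)) = 669 / 125 := by norm_num
  rw [e] at key
  exact not_mem D h key

end CertData

end LawDec
end Quant
end Summit.CriticalPhenomena.PercolationContinuityZ3.Theorems
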